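import Summits.Ventures.PercRepro.C026OneHub
import Summits.Ventures.PercRepro.C026TwoHubCount
import Summits.Ventures.PercRepro.C026GoodDegreeBridge

/-!
# `(G⅔)` on the one-hub class, concluded: `n(D,A) = N + 2P`, `#Good_a = #Good_b = N`, so `P ≤ N`
(p6, gen 22)

On `H = G.attachOneHub a b h` (C026OneHub) a source is `Good_t` iff the hub is `RR`
(`goodA_attachOne_iff`, `goodB_attachOne_iff`): with a red `a`-edge the blue cluster of `a` is
`{a}`, which a hub-graph walk never meets, and the red hub edge to `b` finishes the walk; conversely
the walk's last edge is a red hub edge into `b` whose hub is outside `D_a`, so its `a`-edge is red.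
Splitting the sources by the two hub edges (`card_fibre_one`, `card_eq_sum_patterns_one`):
`n(D,A) = N + 2·P` with `N = #{c ~_red h}` (the `RR` fibre) and `P = #{c ~_red h ∧ c ≁_blue h}` (the
`RB` and `BR` fibres), `#Good_a = #Good_b = N`, and ROW C-041 `(G⅔)` on the class is
`2(N + 2P) ≤ 6N`, i.e. `P ≤ N` (`oneHub_goodDegree`); THEOREM L2 follows
(`pFun_threeCells_nonneg_oneHub`).  Equality iff `P = N`: a red `c`–`h` connection never comes
with a blue one — the hub family proper (`G⁺` a path from `c` to `h`).
-/

namespace PercRepro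

namespace MultiGraph

open Finset

variable {V E : Type*} {G : MultiGraph V E} {a b h c : V}

section Good

variable (hab : a ≠ b) (hca : c ≠ a) (hcb : c ≠ b) (hha : h ≠ a) (hhb : h ≠ b)
  (hisoa : ∀ e, G.fst e ≠ a ∧ G.snd e ≠ a) (hisob : ∀ e, G.fst e ≠ b ∧ G.snd e ≠ b)

/-- The hub-graph walk is a walk of the attachment. -/
theorem walkAvoiding_attachOne_of_walkAvoiding {S : Config (E ⊕ Fin 3)} {W : Set V} {x y : V}
    (hw : G.WalkAvoiding (S ∘ Sum.inl) W x y) : (G.attachOneHub a b h).WalkAvoiding S W x y :=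
  ⟨hw.1, reflTransGen_of_imp (fun _ _ hxy => ⟨openAdj_attachOne_of_openAdj hxy.1, hxy.2⟩) hw.2⟩

include hab hca hcb hha hhb hisoa hisob in
/-- **`Good_a` on the one-hub class**: a source is `Good_a` iff the hub is `RR`. -/
theorem goodA_attachOne_iff {S : Config (E ⊕ Fin 3)}
    (hS : ((G.attachOneHub a b h).Conn S c a ∧ (G.attachOneHub a b h).Conn S c b) ∧
      (¬ (G.attachOneHub a b h).Conn Sᶜ c a ∧ ¬ (G.attachOneHub a b h).Conn Sᶜ c b ∧
        ¬ (G.attachOneHub a b h).Conn Sᶜ a b)) :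
    (G.attachOneHub a b h).WalkAvoiding S ((G.attachOneHub a b h).cluster Sᶜ a) c b ↔
      S (Sum.inr 0) = true ∧ S (Sum.inr 1) = true := by
  obtain ⟨h2, h01, hR, -, -⟩ := (DA_attachOne_iff hab hca hcb hha hhb hisoa hisob S).1 hS
  have hbDa : b ∉ (G.attachOneHub a b h).cluster Sᶜ a := fun hmem =>
    hS.2.2.2 ((G.attachOneHub a b h).mem_cluster.1 hmem)
  have haDa : a ∈ (G.attachOneHub a b h).cluster Sᶜ a := (G.attachOneHub a b h).self_mem_cluster _ a
  constructor
  · intro hw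
    have hcb' : c ∉ ({b} : Set V) := by simpa using hcb
    obtain ⟨x, hx, w, hw', hwalk, hxw⟩ := exists_entry hw.2 hcb' (Set.mem_singleton b)
    rw [Set.mem_singleton_iff] at hw' hx
    rw [hw'] at hxw
    have hwalk' : (G.attachOneHub a b h).WalkAvoiding S
        ((G.attachOneHub a b h).cluster Sᶜ a ∪ {b}) c x :=
      walkAvoiding_union_of_walkAvoiding hcb' hwalk hw.1
    have hxDa : x ∉ (G.attachOneHub a b h).cluster Sᶜ a := fun hmem =>
      hwalk'.not_mem_right (Or.inl hmem)
    obtain ⟨f, hf, hend⟩ := hxw.1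
    rcases f with e | i
    · exfalso
      rcases hend with ⟨_, h2'⟩ | ⟨h1, _⟩
      · exact (hisob e).2 h2'
      · exact (hisob e).1 h1
    · fin_cases i
      · exfalso
        rcases hend with ⟨_, h2'⟩ | ⟨h1, _⟩
        · exact hab (show a = b from h2')
        · exact hhb (show h = b from h1)
      · rcases hend with ⟨h1, _⟩ | ⟨h1, _⟩
        · have hxh : x = h := (show h = x from h1).symm
          rw [hxh] at hxDa
          refine ⟨?_, hf⟩
          by_contra h0
          rw [Bool.not_eq_true] at h0
          exact hxDa ((G.attachOneHub a b h).mem_cluster.2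
            (Conn.of_openAdj (openAdj_attachOne_compl_inr (G := G) (a := a) (b := b) (h := h) h0)).symm)
        · exact absurd (show h = b from h1) hhb
      · exfalso
        rcases hend with ⟨h1, _⟩ | ⟨h1, _⟩
        · exact hxDa ((show a = x from h1) ▸ haDa)
        · exact hab (show a = b from h1)
  · rintro ⟨h0, h1⟩
    have hDa : (G.attachOneHub a b h).cluster Sᶜ a ⊆ ({a} : Set V) := by
      intro v hv
      have := cluster_compl_a_subset_one hab hha hhb hisoa hisob h2 h01 hv
      simp only [Set.mem_union, Set.mem_singleton_iff, Set.mem_setOf_eq, h0, Bool.true_eq_false,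
        false_and, or_false] at this
      exact this
    have hG : G.WalkAvoiding (S ∘ Sum.inl) ({a} : Set V) c h :=
      walkAvoiding_of_conn_of_isolated (fun w hw => by
        rw [Set.mem_singleton_iff] at hw
        rw [hw]
        exact hisoa) (by simpa using hca) hR
    have := walkAvoiding_attachOne_of_walkAvoiding (a := a) (b := b) (h := h) (hG.mono_set hDa)
    exact ⟨this.1, this.2.tail ⟨openAdj_attachOne_inr (G := G) (a := a) (b := b) (h := h) h1, hbDa⟩⟩

include hab hca hcb hha hhb hisoa hisob in
/-- **`Good_b` on the one-hub class**: a source is `Good_b` iff the hub is `RR`. -/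
theorem goodB_attachOne_iff {S : Config (E ⊕ Fin 3)}
    (hS : ((G.attachOneHub a b h).Conn S c a ∧ (G.attachOneHub a b h).Conn S c b) ∧
      (¬ (G.attachOneHub a b h).Conn Sᶜ c a ∧ ¬ (G.attachOneHub a b h).Conn Sᶜ c b ∧
        ¬ (G.attachOneHub a b h).Conn Sᶜ a b)) :
    (G.attachOneHub a b h).WalkAvoiding S ((G.attachOneHub a b h).cluster Sᶜ b) c a ↔
      S (Sum.inr 0) = true ∧ S (Sum.inr 1) = true := by
  obtain ⟨h2, h01, hR, -, -⟩ := (DA_attachOne_iff hab hca hcb hha hhb hisoa hisob S).1 hS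
  have haDb : a ∉ (G.attachOneHub a b h).cluster Sᶜ b := fun hmem =>
    hS.2.2.2 ((G.attachOneHub a b h).mem_cluster.1 hmem).symm
  have hbDb : b ∈ (G.attachOneHub a b h).cluster Sᶜ b := (G.attachOneHub a b h).self_mem_cluster _ b
  constructor
  · intro hw
    have hca' : c ∉ ({a} : Set V) := by simpa using hca
    obtain ⟨x, hx, w, hw', hwalk, hxw⟩ := exists_entry hw.2 hca' (Set.mem_singleton a)
    rw [Set.mem_singleton_iff] at hw' hx
    rw [hw'] at hxw
    have hwalk' : (G.attachOneHub a b h).WalkAvoiding S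
        ((G.attachOneHub a b h).cluster Sᶜ b ∪ {a}) c x :=
      walkAvoiding_union_of_walkAvoiding hca' hwalk hw.1
    have hxDb : x ∉ (G.attachOneHub a b h).cluster Sᶜ b := fun hmem =>
      hwalk'.not_mem_right (Or.inl hmem)
    obtain ⟨f, hf, hend⟩ := hxw.1
    rcases f with e | i
    · exfalso
      rcases hend with ⟨_, h2'⟩ | ⟨h1, _⟩
      · exact (hisoa e).2 h2'
      · exact (hisoa e).1 h1
    · fin_cases i
      · rcases hend with ⟨h1, _⟩ | ⟨h1, _⟩
        · have hxh : x = h := (show h = x from h1).symm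
          rw [hxh] at hxDb
          refine ⟨hf, ?_⟩
          by_contra h1'
          rw [Bool.not_eq_true] at h1'
          exact hxDb ((G.attachOneHub a b h).mem_cluster.2
            (Conn.of_openAdj (openAdj_attachOne_compl_inr (G := G) (a := a) (b := b) (h := h) h1')).symm)
        · exact absurd (show h = a from h1) hha
      · exfalso
        rcases hend with ⟨_, h2'⟩ | ⟨h1, _⟩
        · exact hab (show b = a from h2').symm
        · exact hha (show h = a from h1)
      · exfalso
        rcases hend with ⟨h1, _⟩ | ⟨_, h2'⟩
        · exact hx (show a = x from h1).symm
        · exact hxDb ((show b = x from h2') ▸ hbDb)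
  · rintro ⟨h0, h1⟩
    have hDb : (G.attachOneHub a b h).cluster Sᶜ b ⊆ ({b} : Set V) := by
      intro v hv
      have := cluster_compl_b_subset_one hab hha hhb hisoa hisob h2 h01 hv
      simp only [Set.mem_union, Set.mem_singleton_iff, Set.mem_setOf_eq, h1, Bool.true_eq_false,
        false_and, or_false] at this
      exact this
    have hG : G.WalkAvoiding (S ∘ Sum.inl) ({b} : Set V) c h :=
      walkAvoiding_of_conn_of_isolated (fun w hw => by
        rw [Set.mem_singleton_iff] at hw
        rw [hw]
        exact hisob) (by simpa using hcb) hR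
    have := walkAvoiding_attachOne_of_walkAvoiding (a := a) (b := b) (h := h) (hG.mono_set hDb)
    exact ⟨this.1, this.2.tail ⟨openAdj_attachOne_inr (G := G) (a := a) (b := b) (h := h) h0, haDb⟩⟩

end Good

section Count

variable [Fintype E] [DecidableEq E]

/-- The fibre of a hub pattern on the one-hub skeleton: `S ↦ S ∘ Sum.inl` is a bijection onto the
hub-graph colourings `O` with `Sum.elim O ![p0, p1, p2] ∈ s`, when `s` forces the terminal edge to
`p2`. -/
theorem card_fibre_one (p0 p1 p2 : Bool) (s : Finset (Config (E ⊕ Fin 3)))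
    (hs : ∀ S ∈ s, S (Sum.inr 2) = p2) :
    (s.filter fun S : Config (E ⊕ Fin 3) => (S (Sum.inr 0), S (Sum.inr 1)) = (p0, p1)).card =
      (univ.filter fun O : Config E => Sum.elim O ![p0, p1, p2] ∈ s).card := by
  have key : ∀ S ∈ s, (S (Sum.inr 0), S (Sum.inr 1)) = (p0, p1) →
      Sum.elim (S ∘ Sum.inl) ![p0, p1, p2] = S := by
    intro S hS hq
    simp only [Prod.mk.injEq] at hq
    obtain ⟨h0, h1⟩ := hq
    have h2 := hs S hS
    funext f
    rcases f with e | i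
    · rfl
    · fin_cases i
      · exact h0.symm
      · exact h1.symm
      · exact h2.symm
  refine Finset.card_bij' (fun S _ => S ∘ Sum.inl) (fun O _ => Sum.elim O ![p0, p1, p2]) ?_ ?_ ?_ ?_
  · intro S hS
    simp only [mem_filter, mem_univ, true_and] at hS ⊢
    rw [key S hS.1 hS.2]
    exact hS.1
  · intro O hO
    simp only [mem_filter, mem_univ, true_and] at hO ⊢
    exact ⟨hO, rfl⟩
  · intro S hS
    simp only [mem_filter] at hS
    exact key S hS.1 hS.2
  · intro O _
    rfl

omit [Fintype E] [DecidableEq E] in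
/-- A count splits along the two hub edges. -/
theorem card_eq_sum_patterns_one (s : Finset (Config (E ⊕ Fin 3))) :
    s.card = ∑ t : Bool × Bool, (s.filter fun S : Config (E ⊕ Fin 3) =>
        (S (Sum.inr 0), S (Sum.inr 1)) = t).card :=
  Finset.card_eq_sum_card_fiberwise (fun _ _ => mem_univ _)

/-- The four terms of a sum over two Booleans. -/
theorem sum_bool_two (g : Bool × Bool → ℕ) :
    ∑ t, g t = g (true, true) + g (true, false) + g (false, true) + g (false, false) := by
  simp only [Fintype.sum_prod_type, Fintype.sum_bool]
  ring

omit [Fintype E] [DecidableEq E] in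
/-- The `BB` fibre is empty in a set that forbids it. -/
theorem card_fibre_bb_one (s : Finset (Config (E ⊕ Fin 3)))
    (hs : ∀ S ∈ s, S (Sum.inr 0) = true ∨ S (Sum.inr 1) = true) :
    (s.filter fun S : Config (E ⊕ Fin 3) =>
      (S (Sum.inr 0), S (Sum.inr 1)) = (false, false)).card = 0 := by
  rw [Finset.card_eq_zero, Finset.filter_eq_empty_iff]
  intro S hS hq
  simp only [Prod.mk.injEq] at hq
  rcases hs S hS with h0 | h1
  · exact Bool.false_ne_true (hq.1.symm.trans h0)
  · exact Bool.false_ne_true (hq.2.symm.trans h1)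

variable (hab : a ≠ b) (hca : c ≠ a) (hcb : c ≠ b) (hha : h ≠ a) (hhb : h ≠ b)
  (hisoa : ∀ e, G.fst e ≠ a ∧ G.snd e ≠ a) (hisob : ∀ e, G.fst e ≠ b ∧ G.snd e ≠ b)

include hab hca hcb hha hhb hisoa hisob in
open Classical in
/-- **`(G⅔)` ON THE ONE-HUB CLASS**: `2·n(D,A) ≤ 3·(#Good_a + #Good_b)` on `G.attachOneHub a b h`,
with `n(D,A) = N + 2P` and `#Good_a = #Good_b = N` — the inequality is `P ≤ N`. -/
theorem oneHub_goodDegree :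
    2 * (univ.filter fun S : Config (E ⊕ Fin 3) =>
        ((G.attachOneHub a b h).Conn S c a ∧ (G.attachOneHub a b h).Conn S c b) ∧
        (¬ (G.attachOneHub a b h).Conn Sᶜ c a ∧ ¬ (G.attachOneHub a b h).Conn Sᶜ c b ∧
          ¬ (G.attachOneHub a b h).Conn Sᶜ a b)).card ≤
      3 * ((univ.filter fun S : Config (E ⊕ Fin 3) =>
          (((G.attachOneHub a b h).Conn S c a ∧ (G.attachOneHub a b h).Conn S c b) ∧
          (¬ (G.attachOneHub a b h).Conn Sᶜ c a ∧ ¬ (G.attachOneHub a b h).Conn Sᶜ c b ∧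
            ¬ (G.attachOneHub a b h).Conn Sᶜ a b)) ∧
          (G.attachOneHub a b h).WalkAvoiding S ((G.attachOneHub a b h).cluster Sᶜ a) c b).card +
        (univ.filter fun S : Config (E ⊕ Fin 3) =>
          (((G.attachOneHub a b h).Conn S c a ∧ (G.attachOneHub a b h).Conn S c b) ∧
          (¬ (G.attachOneHub a b h).Conn Sᶜ c a ∧ ¬ (G.attachOneHub a b h).Conn Sᶜ c b ∧
            ¬ (G.attachOneHub a b h).Conn Sᶜ a b)) ∧
          (G.attachOneHub a b h).WalkAvoiding S ((G.attachOneHub a b h).cluster Sᶜ b) c a).card) := by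
  have hiff := DA_attachOne_iff (G := G) hab hca hcb hha hhb hisoa hisob
  have hgA := fun S : Config (E ⊕ Fin 3) =>
    goodA_attachOne_iff (G := G) (S := S) hab hca hcb hha hhb hisoa hisob
  have hgB := fun S : Config (E ⊕ Fin 3) =>
    goodB_attachOne_iff (G := G) (S := S) hab hca hcb hha hhb hisoa hisob
  -- the three sets and their membership in hub-graph terms
  set s : Finset (Config (E ⊕ Fin 3)) := univ.filter fun S : Config (E ⊕ Fin 3) =>
    ((G.attachOneHub a b h).Conn S c a ∧ (G.attachOneHub a b h).Conn S c b) ∧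
      (¬ (G.attachOneHub a b h).Conn Sᶜ c a ∧ ¬ (G.attachOneHub a b h).Conn Sᶜ c b ∧
        ¬ (G.attachOneHub a b h).Conn Sᶜ a b) with hs_def
  set sA : Finset (Config (E ⊕ Fin 3)) := univ.filter fun S : Config (E ⊕ Fin 3) =>
    (((G.attachOneHub a b h).Conn S c a ∧ (G.attachOneHub a b h).Conn S c b) ∧
      (¬ (G.attachOneHub a b h).Conn Sᶜ c a ∧ ¬ (G.attachOneHub a b h).Conn Sᶜ c b ∧
        ¬ (G.attachOneHub a b h).Conn Sᶜ a b)) ∧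
      (G.attachOneHub a b h).WalkAvoiding S ((G.attachOneHub a b h).cluster Sᶜ a) c b with hsA_def
  set sB : Finset (Config (E ⊕ Fin 3)) := univ.filter fun S : Config (E ⊕ Fin 3) =>
    (((G.attachOneHub a b h).Conn S c a ∧ (G.attachOneHub a b h).Conn S c b) ∧
      (¬ (G.attachOneHub a b h).Conn Sᶜ c a ∧ ¬ (G.attachOneHub a b h).Conn Sᶜ c b ∧
        ¬ (G.attachOneHub a b h).Conn Sᶜ a b)) ∧
      (G.attachOneHub a b h).WalkAvoiding S ((G.attachOneHub a b h).cluster Sᶜ b) c a with hsB_def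
  have hmem : ∀ S, S ∈ s ↔ (S (Sum.inr 2) = true ∧ (S (Sum.inr 0) = true ∨ S (Sum.inr 1) = true) ∧
      G.Conn (S ∘ Sum.inl) c h ∧
      (S (Sum.inr 0) = false → ¬ G.Conn (S ∘ Sum.inl)ᶜ c h) ∧
      (S (Sum.inr 1) = false → ¬ G.Conn (S ∘ Sum.inl)ᶜ c h)) := by
    intro S
    rw [hs_def, mem_filter]
    simp only [mem_univ, true_and]
    exact hiff S
  have hmemA : ∀ S, S ∈ sA ↔ (S (Sum.inr 2) = true ∧ (S (Sum.inr 0) = true ∨ S (Sum.inr 1) = true) ∧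
      G.Conn (S ∘ Sum.inl) c h ∧
      (S (Sum.inr 0) = false → ¬ G.Conn (S ∘ Sum.inl)ᶜ c h) ∧
      (S (Sum.inr 1) = false → ¬ G.Conn (S ∘ Sum.inl)ᶜ c h)) ∧
      (S (Sum.inr 0) = true ∧ S (Sum.inr 1) = true) := by
    intro S
    rw [hsA_def, mem_filter]
    simp only [mem_univ, true_and]
    constructor
    · rintro ⟨hS, hg⟩
      exact ⟨(hiff S).1 hS, (hgA S hS).1 hg⟩
    · rintro ⟨hS, hg⟩
      have hS' := (hiff S).2 hS
      exact ⟨hS', (hgA S hS').2 hg⟩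
  have hmemB : ∀ S, S ∈ sB ↔ (S (Sum.inr 2) = true ∧ (S (Sum.inr 0) = true ∨ S (Sum.inr 1) = true) ∧
      G.Conn (S ∘ Sum.inl) c h ∧
      (S (Sum.inr 0) = false → ¬ G.Conn (S ∘ Sum.inl)ᶜ c h) ∧
      (S (Sum.inr 1) = false → ¬ G.Conn (S ∘ Sum.inl)ᶜ c h)) ∧
      (S (Sum.inr 0) = true ∧ S (Sum.inr 1) = true) := by
    intro S
    rw [hsB_def, mem_filter]
    simp only [mem_univ, true_and]
    constructor
    · rintro ⟨hS, hg⟩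
      exact ⟨(hiff S).1 hS, (hgB S hS).1 hg⟩
    · rintro ⟨hS, hg⟩
      have hS' := (hiff S).2 hS
      exact ⟨hS', (hgB S hS').2 hg⟩
  have h2 : ∀ S ∈ s, S (Sum.inr 2) = true := fun S hS => ((hmem S).1 hS).1
  have h01 : ∀ S ∈ s, S (Sum.inr 0) = true ∨ S (Sum.inr 1) = true := fun S hS => ((hmem S).1 hS).2.1
  have h2A : ∀ S ∈ sA, S (Sum.inr 2) = true := fun S hS => ((hmemA S).1 hS).1.1
  have h01A : ∀ S ∈ sA, S (Sum.inr 0) = true ∨ S (Sum.inr 1) = true :=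
    fun S hS => ((hmemA S).1 hS).1.2.1
  have h2B : ∀ S ∈ sB, S (Sum.inr 2) = true := fun S hS => ((hmemB S).1 hS).1.1
  have h01B : ∀ S ∈ sB, S (Sum.inr 0) = true ∨ S (Sum.inr 1) = true :=
    fun S hS => ((hmemB S).1 hS).1.2.1
  rw [card_eq_sum_patterns_one s, card_eq_sum_patterns_one sA, card_eq_sum_patterns_one sB,
    sum_bool_two, sum_bool_two, sum_bool_two, card_fibre_bb_one s h01, card_fibre_bb_one sA h01A,
    card_fibre_bb_one sB h01B, card_fibre_one true true true s h2, card_fibre_one true false true s h2,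
    card_fibre_one false true true s h2, card_fibre_one true true true sA h2A,
    card_fibre_one true false true sA h2A, card_fibre_one false true true sA h2A,
    card_fibre_one true true true sB h2B, card_fibre_one true false true sB h2B,
    card_fibre_one false true true sB h2B]
  simp only [hmem, hmemA, hmemB, Sum.elim_inr, Sum.elim_comp_inl, Matrix.cons_val_zero,
    Matrix.cons_val_one, Matrix.head_cons, Matrix.cons_val_two, Matrix.tail_cons,
    Bool.true_eq_false, Bool.false_eq_true, or_false, or_true, true_and, and_true, and_false,
    IsEmpty.forall_iff, forall_const, and_self, Finset.filter_false, Finset.card_empty]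
  have hP : (univ.filter fun O : Config E => G.Conn O c h ∧ ¬ G.Conn Oᶜ c h).card ≤
      (univ.filter fun O : Config E => G.Conn O c h).card :=
    Finset.card_le_card fun O hO => by
      simp only [mem_filter, mem_univ, true_and] at hO ⊢
      exact hO.1
  omega

include hab hca hcb hha hhb hisoa hisob in
open Classical in
/-- **THEOREM L2 on the one-hub class.** -/
theorem pFun_threeCells_nonneg_oneHub [Fintype V] [DecidableEq V]
    {z κ x₁ K₁ x₂ K₂ : ℝ} (hz : 0 ≤ z ∧ z ≤ 1) (hκ : kMin z ≤ κ) (hx₁ : 0 ≤ x₁ ∧ x₁ ≤ 1)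
    (hx₂ : 0 ≤ x₂ ∧ x₂ ≤ 1) (hK₁ : kMin x₁ ≤ K₁) (hK₂ : kMin x₂ ≤ K₂) :
    0 ≤ (G.attachOneHub a b h).pFun c (threeCells c a b z x₁ x₂) (threeCells c a b κ K₁ K₂) univ :=
  pFun_threeCells_nonneg_of_goodDegree a b c
    (oneHub_goodDegree hab hca hcb hha hhb hisoa hisob) hz hκ hx₁ hx₂ hK₁ hK₂

end Count

end MultiGraph

end PercRepro
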